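import Summits.SmoothPoincare4.SmoothPoincare4.Theorems.SymplecticOrigamiOrigamiFoldExistenceStubOuterCleanRecognitionChartCapMap

/-!
# Stub `stub_outerSideLemma` of line `shadow-pleats` for crux `OrigamiFoldExistence` — O′:
# the cap map is IMMERSIVE on the cap (tangent directions), `ℝ⁵`-calculus form
(item stmt-SmoothPoincare4-7844, route SymplecticOrigami; seat c5, complementary lead on O1)

WHAT.  `eq_zero_of_mfderiv_capMap_eq_zero`: for `0 < δ < 1`, at a point `p` of the unit sphere of
`ℝ⁵` with `p₄ ≤ 1 − δ`, a vector `w ⊥ p` (a tangent vector of the sphere) killed by the differential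
of THE CAP MAP `capMap δ : ℝ⁵ → S⁴` of file N (`…ChartCapMap`,
`capMap δ q = R_N (λ ((4 / P(q₄)) • proj5 q))`, `λ = liftS4 = σ_N⁻¹`, `R_N = poleReflectionSphere N`,
`P = capP δ` the profile of file M `…ChartCapProfile`) is zero.  This is literally the hypothesis
`hCd` of file Q (`…ChartPsi`, `injective_mfderiv_psiMap`) for `C = capMap δ`.

FROM WHAT.  The chain rule through the diffeomorphism `R_N` (injective differential,
`Diffeomorph.mfderivToContinuousLinearEquiv`) and the immersion `λ` (`injective_mfderiv_liftS4`)
reduces `d(capMap δ)_p w = 0` to `d(capPre δ)_p w = 0` for the pre-map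
`capPre δ q = (4 / P(q₄)) • proj5 q : ℝ⁵ → ℝ⁴`, whose derivative is computed here
(`hasFDerivAt_capPre`):  `d(capPre δ)_p w = (4/P) proj5 w − (4 P′ w₄ / P²) proj5 p` (`P, P′` at
`t = p₄`).  Pairing with `proj5 p` (`‖proj5 p‖² = 1 − t²` on the sphere) and using
`0 = ⟪p, w⟫ = ⟪proj5 p, proj5 w⟫ + t w₄` gives `w₄ (P′(1 − t²) + t P) = 0`; the bracket is negative
on `[−1, 1)` (THE KEY SIGN `capKey_neg` of file M, plus the south pole `t = −1` where it is `−P(−1)`),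
so `w₄ = 0`, then `proj5 w = 0`, then `w = 0`.

WHY.  Last input of the side lemma (O1) `outerSideLemma_of_capImmersive` (the lead's file ε) and of
seat c4's `stub_outerCleanRecognitionOfSide`: with `image_capMap`, `injOn_capMap` (file N) it makes
`capMap δ` a smooth embedding of the cap `{‖p‖ = 1, p₄ ≤ 1 − δ}` onto `S⁴ ∖ λ(B_ρ)`.

Sources: elementary calculus over Mathlib (`HasFDerivAt.smul`, `HasDerivAt.comp_hasFDerivAt`,
`HasMFDerivAt.comp`); the lead's `OuterClean-analysis-c3.md` §3 (O2)(d).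
-/

noncomputable section

-- the prescribed namespace `Summit.<P>.<Sub>.…` duplicates `SmoothPoincare4` (P = Sub)
set_option linter.dupNamespace false

open scoped Manifold ContDiff Topology RealInnerProductSpace
open Set Function Filter Metric
open Literature.Topology.FourManifolds

namespace Summit.SmoothPoincare4.SmoothPoincare4.Theorems.OrigamiFoldExistence.ShadowPleats

/-! ### Elementary pieces: `ℝ⁵ = ℝ⁴ × ℝ`, the key sign on `[−1, 1)`, the algebra -/

/-- `⟪p, w⟫ = ⟪proj5 p, proj5 w⟫ + p₄ w₄` in `ℝ⁵ = ℝ⁴ × ℝ`. -/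
theorem inner_eq_inner_proj5_add_mul (p w : EuclideanSpace ℝ (Fin 5)) :
    ⟪p, w⟫ = ⟪proj5 p, proj5 w⟫ + p 4 * w 4 := by
  simp [PiLp.inner_apply, Fin.sum_univ_five, Fin.sum_univ_four, proj5]
  ring

/-- THE KEY SIGN of file M on the half-open interval `[−1, 1)`, in terms of `deriv (capP δ)`:
`P′(t)(1 − t²) + t P(t) < 0` (at the south pole `t = −1` it is `−P(−1) < 0`). -/
theorem deriv_capP_key_neg {δ : ℝ} (hδ1 : δ < 1) {t : ℝ} (ht1 : -1 ≤ t) (ht2 : t < 1) :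
    deriv (capP δ) t * (1 - t ^ 2) + t * capP δ t < 0 := by
  rw [(hasDerivAt_capP hδ1 t).deriv]
  rcases ht1.eq_or_lt with h | h
  · subst h
    have hP := capP_pos hδ1 ht2
    norm_num
    exact hP
  · exact capKey_neg hδ1 h ht2

/-- The algebra of the proof: from `a X + γ w₄ (1 − t²) = 0` (the derivative equation paired with
`proj5 p`), `X + t w₄ = 0` (tangency), `a P = 4`, `γ P² = −4P′` and the key sign, `w₄ = 0`. -/
theorem apply_four_eq_zero_of_key {P P' t X w4 γ a : ℝ} (ha : a * P = 4) (hγ : γ * P ^ 2 = -(4 * P'))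
    (hkey : P' * (1 - t ^ 2) + t * P < 0) (h1 : a * X + γ * w4 * (1 - t ^ 2) = 0)
    (h2 : X + t * w4 = 0) : w4 = 0 := by
  have h : w4 * (P' * (1 - t ^ 2) + t * P) = 0 := by
    linear_combination (-(1 : ℝ) / 4 * P ^ 2) * h1 + P * h2 + (1 / 4 * P * X) * ha +
      (1 / 4 * w4 * (1 - t ^ 2)) * hγ
  rcases mul_eq_zero.1 h with h | h
  · exact h
  · exact absurd h hkey.ne

/-! ### The derivative of the pre-map `q ↦ (4 / P(q₄)) • proj5 q` -/

/-- **The derivative of the pre-map** on `{q₄ < 1}`: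
`d(capPre δ)_p = (4 / P(p₄)) proj5 + (−4 P′(p₄) / P(p₄)²) (dq₄) ⊗ proj5 p`. -/
theorem hasFDerivAt_capPre {δ : ℝ} (hδ1 : δ < 1) {p : EuclideanSpace ℝ (Fin 5)} (hp4 : p 4 < 1) :
    HasFDerivAt (capPre δ)
      ((4 / capP δ (p 4)) • proj5L +
        ((-(4 * deriv (capP δ) (p 4)) / capP δ (p 4) ^ 2) • heightL).smulRight (proj5 p)) p := by
  have hP : 0 < capP δ (p 4) := capP_pos hδ1 hp4
  have hPt : HasDerivAt (capP δ) (deriv (capP δ) (p 4)) (p 4) :=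
    (hasDerivAt_capP hδ1 (p 4)).differentiableAt.hasDerivAt
  have hg1 : HasDerivAt (fun s : ℝ => 4 / capP δ s) (-(4 * deriv (capP δ) (p 4)) / capP δ (p 4) ^ 2) (p 4) :=
    ((hasDerivAt_const (p 4) (4 : ℝ)).div hPt hP.ne').congr_deriv (by ring)
  have hg : HasFDerivAt ((fun s : ℝ => 4 / capP δ s) ∘ (heightL : EuclideanSpace ℝ (Fin 5) → ℝ))
      ((-(4 * deriv (capP δ) (p 4)) / capP δ (p 4) ^ 2) • heightL) p :=
    HasDerivAt.comp_hasFDerivAt p hg1 heightL.hasFDerivAt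
  exact hg.smul proj5L.hasFDerivAt

/-! ### The cap map is immersive on the cap -/

/-- **THE CAP MAP IS IMMERSIVE ON THE CAP** (`ℝ⁵`-calculus form of file Q's hypothesis `hCd`): at a point `p` of
the unit sphere with `p₄ ≤ 1 - δ`, a vector `w` tangent to the sphere (`⟪p, w⟫ = 0`) killed by the differential of
`capMap δ` is zero. [folklore] -/
theorem eq_zero_of_mfderiv_capMap_eq_zero {δ : ℝ} (hδ : 0 < δ) (hδ1 : δ < 1)
    {p : EuclideanSpace ℝ (Fin 5)} (hp1 : ‖p‖ = 1) (hp4 : p 4 ≤ 1 - δ)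
    {w : EuclideanSpace ℝ (Fin 5)} (hpw : ⟪p, w⟫ = 0)
    (h0 : mfderiv 𝓘(ℝ, EuclideanSpace ℝ (Fin 5)) (𝓡 4) (capMap δ) p w = 0) : w = 0 := by
  have hp4' : p 4 < 1 := by linarith
  have hP : 0 < capP δ (p 4) := capP_pos hδ1 hp4'
  -- the chain rule `d(capMap δ)_p = dR_N ∘ dλ ∘ d(capPre δ)_p`, the two outer factors injective
  have h1 := (hasFDerivAt_capPre hδ1 hp4').hasMFDerivAt
  have h2 : HasMFDerivAt (𝓡 4) (𝓡 4) liftS4 (capPre δ p) (mfderiv (𝓡 4) (𝓡 4) liftS4 (capPre δ p)) :=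
    ((contMDiff_liftS4 _).mdifferentiableAt (by simp)).hasMFDerivAt
  have h3 : HasMFDerivAt (𝓡 4) (𝓡 4) (poleReflectionSphere (n := 4) northPole) (liftS4 (capPre δ p))
      (mfderiv (𝓡 4) (𝓡 4) (poleReflectionSphere (n := 4) northPole) (liftS4 (capPre δ p))) :=
    (((poleReflectionSphere (n := 4) northPole).contMDiff _).mdifferentiableAt (by simp)).hasMFDerivAt
  have hmf : mfderiv 𝓘(ℝ, EuclideanSpace ℝ (Fin 5)) (𝓡 4) (capMap δ) p = _ := (h3.comp p (h2.comp p h1)).mfderiv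
  rw [hmf] at h0
  have hD3 : Injective (mfderiv (𝓡 4) (𝓡 4) (poleReflectionSphere (n := 4) northPole) (liftS4 (capPre δ p))) :=
    ((poleReflectionSphere (n := 4) northPole).mfderivToContinuousLinearEquiv (by simp) (liftS4 (capPre δ p))).injective
  have hLw : ((4 / capP δ (p 4)) • proj5L +
      ((-(4 * deriv (capP δ) (p 4)) / capP δ (p 4) ^ 2) • heightL).smulRight (proj5 p)) w = 0 := by
    have e2 : mfderiv (𝓡 4) (𝓡 4) liftS4 (capPre δ p) (((4 / capP δ (p 4)) • proj5L +
        ((-(4 * deriv (capP δ) (p 4)) / capP δ (p 4) ^ 2) • heightL).smulRight (proj5 p)) w) = 0 :=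
      (injective_iff_map_eq_zero _).1 hD3 _ h0
    exact (injective_iff_map_eq_zero _).1 (injective_mfderiv_liftS4 (capPre δ p)) _ e2
  -- the derivative equation `(4/P) proj5 w + (γ w₄) proj5 p = 0`, paired with `proj5 p`, and tangency
  have hvec : (4 / capP δ (p 4)) • proj5 w + (-(4 * deriv (capP δ) (p 4)) / capP δ (p 4) ^ 2 * w 4) • proj5 p = 0 := by
    simpa only [add_apply, smul_apply, ContinuousLinearMap.smulRight_apply,
      proj5L_apply, heightL_apply, smul_eq_mul] using hLw
  have hxsq : ‖proj5 p‖ ^ 2 = 1 - (p 4) ^ 2 := norm_proj5_sq_of_mem_sphere (by simpa using hp1)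
  have hs1 : 4 / capP δ (p 4) * ⟪proj5 p, proj5 w⟫ +
      -(4 * deriv (capP δ) (p 4)) / capP δ (p 4) ^ 2 * w 4 * (1 - (p 4) ^ 2) = 0 := by
    have := congrArg (fun v => ⟪proj5 p, v⟫) hvec
    simp only [inner_add_right, inner_smul_right, inner_zero_right, real_inner_self_eq_norm_sq, hxsq] at this
    linear_combination this
  have hs2 : ⟪proj5 p, proj5 w⟫ + p 4 * w 4 = 0 := by rw [← inner_eq_inner_proj5_add_mul]; exact hpw
  -- `w₄ = 0` by the key sign, then `proj5 w = 0`, then `w = 0`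
  have hkey := deriv_capP_key_neg hδ1 (abs_le.1 (abs_apply_four_le hp1)).1 hp4'
  have hw4 : w 4 = 0 :=
    apply_four_eq_zero_of_key (div_mul_cancel₀ _ hP.ne') (div_mul_cancel₀ _ (pow_ne_zero 2 hP.ne')) hkey hs1 hs2
  have hw : proj5 w = 0 := by
    rw [hw4, mul_zero, zero_smul, add_zero] at hvec
    exact (smul_eq_zero.1 hvec).resolve_left (div_ne_zero four_ne_zero hP.ne')
  have hcoords := apply_eq_zero_of_proj5_eq_zero hw
  ext i
  fin_cases i
  · simpa using hcoords 0 (by decide)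
  · simpa using hcoords 1 (by decide)
  · simpa using hcoords 2 (by decide)
  · simpa using hcoords 3 (by decide)
  · simpa using hw4

end Summit.SmoothPoincare4.SmoothPoincare4.Theorems.OrigamiFoldExistence.ShadowPleats

end
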